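import Summits.HodgeConjecture.CorCM.Census.OcticTwistCover

/-!
# The octic twist `(ℤ/8 × B, (4,0))`, X: THE SHAPE OF THE REDUCING FACE at a type of potential `≥ 2` (explicit case distinction)

COR-CM (cell `pub-hodgecm2`), count-neutral kernel combinatorics by the binder seat b09 (gen 33; lane COINVARIANT-TWIST / OCTIC RECON), on top of
parts I–IV (`Census/OcticTwist{Model,Motion,Reduction,Cover}.lean`) and the quartic files (`QuarticTwistReduction`: `IsRes`; `QuarticTwistCount`:
`exists_goodSquare`, `exists_two_off`; `QuarticTwistResidual`: `atom_ne_cst`, `atom_eq_atom_iff`) BY NAME.  Theorems only; no certificate, no named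
fact, no `sorry`.  HONEST FRAMING: `HC_CM` is NOT proved; nothing here is a period or a headline.

CONTENT (`|B| ≥ 3`).  §1: the column face at a `2`-atom IS the column face at its constant (`faceVec_two_atom`), symmetry of the column face in its
places, a non-residual type has potential `≥ 2`.  §2 **`exists_rel'`** — part IVʼs `exists_rel` with the SHAPE of the face recorded, for use on the
slices (part XI `Census/OcticTwistCoverSlices.lean`): the face through `T` is (1) a coordinate-`0` cross square with `Φ`-smaller corners if `T.1` is
non-residual; (2) the coordinate-`0` column face at `(cst u, T.2)` if `T.1 = u + 2δ_b`; (3)/(4) the same in coordinate `1` otherwise; (5) the MIXED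
square `(e_{T.1} − e_{cst u}) ⊗ (e_{T.2} − e_{cst u′})` when both coordinates are `±1`-atoms.

## References
* [Pohlmann1968] H. Pohlmann, Algebraic cycles on abelian varieties of complex multiplication type, Ann. of Math. 88 (1968), Thm 1.
-/

namespace Summit.HodgeConjecture.CorCM.Census.OcticTwist

open Finset
open Summit.HodgeConjecture.CorCM.Census.QuarticTwist

variable (B : Type) [AddGroup B] [Fintype B] [DecidableEq B]

/-! ## §1 Quartic complements: column faces at `2`-atoms, potential of non-residual types -/

omit [AddGroup B] in
/-- The column face is symmetric in its two places. [folklore] -/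
theorem faceVec_col_comm (s : Ty B) (b : B) :
    faceVec B s ((1 : ZMod 2), b) ((0 : ZMod 2), b) = faceVec B s ((0 : ZMod 2), b) ((1 : ZMod 2), b) := by
  unfold faceVec
  have h1 : QuarticTwist.flip B ((1 : ZMod 2), b) (QuarticTwist.flip B ((0 : ZMod 2), b) s) = s + Pi.single b 2 := by
    rw [show ((1 : ZMod 2), b) = ((0 : ZMod 2) + 1, b) by rw [zero_add]]
    exact flip_flip_same B 0 b s
  have h2 : QuarticTwist.flip B ((0 : ZMod 2), b) (QuarticTwist.flip B ((1 : ZMod 2), b) s) = s + Pi.single b 2 := by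
    rw [show ((0 : ZMod 2), b) = ((1 : ZMod 2) + 1, b) by rw [show (1 : ZMod 2) + 1 = 0 by decide]]
    exact flip_flip_same B 1 b s
  rw [h1, h2]
  abel

omit [AddGroup B] in
/-- **The column face at a `2`-atom is the column face at its constant** (same four corners `u, u ± δ_b, u + 2δ_b`). [folklore] -/
theorem faceVec_two_atom (u : ZMod 4) (b : B) :
    faceVec B (atom B u b 2) ((0 : ZMod 2), b) ((1 : ZMod 2), b) = faceVec B (cst B u) ((0 : ZMod 2), b) ((1 : ZMod 2), b) := by
  unfold faceVec
  have hc1 : QuarticTwist.flip B ((1 : ZMod 2), b) (QuarticTwist.flip B ((0 : ZMod 2), b) (cst B u)) = atom B u b 2 := by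
    rw [show ((1 : ZMod 2), b) = ((0 : ZMod 2) + 1, b) by rw [zero_add], flip_flip_same]
    rfl
  have ha1 : QuarticTwist.flip B ((1 : ZMod 2), b) (QuarticTwist.flip B ((0 : ZMod 2), b) (atom B u b 2)) = cst B u := by
    rw [show ((1 : ZMod 2), b) = ((0 : ZMod 2) + 1, b) by rw [zero_add], flip_flip_same, atom_add_single, show (2 : ZMod 4) + 2 = 0 by decide,
      atom_zero]
  have hc0 : QuarticTwist.flip B ((0 : ZMod 2), b) (cst B u) = atom B u b (step 0 u) := by
    rw [← atom_zero B u b, flip_atom, add_zero, zero_add]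
  have hc0' : QuarticTwist.flip B ((1 : ZMod 2), b) (cst B u) = atom B u b (step 1 u) := by
    rw [← atom_zero B u b, flip_atom, add_zero, zero_add]
  have ha0 : QuarticTwist.flip B ((0 : ZMod 2), b) (atom B u b 2) = atom B u b (2 + step 0 (u + 2)) := flip_atom B 0 u b 2
  have ha0' : QuarticTwist.flip B ((1 : ZMod 2), b) (atom B u b 2) = atom B u b (2 + step 1 (u + 2)) := flip_atom B 1 u b 2
  rw [hc1, ha1, hc0, hc0', ha0, ha0']
  have hs1 : step 1 u = -step 0 u := by rw [show (1 : ZMod 2) = 0 + 1 by rw [zero_add]]; exact step_succ 0 u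
  have hs2 : step 0 (u + 2) = step 0 u := by
    unfold step
    rw [map_add, show par 2 = 0 from by decide, add_zero]
  have hs3 : step 1 (u + 2) = -step 0 u := by
    rw [show (1 : ZMod 2) = 0 + 1 by rw [zero_add], step_succ, hs2]
  rw [hs1, hs2, hs3]
  rcases step_eq_or 0 u with h | h <;> rw [h]
  · rw [show (2 : ZMod 4) + 1 = -1 by decide, show (2 : ZMod 4) + -1 = 1 by decide]; abel
  · rw [show (2 : ZMod 4) + -1 = 1 by decide, show -(-1 : ZMod 4) = 1 by decide, show (2 : ZMod 4) + 1 = -1 by decide]; abel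

omit [AddGroup B] in
/-- **A non-residual type has potential `≥ 2`** (two columns off the regime). [folklore] -/
theorem two_le_Phi_of_not_isRes (h3 : 3 ≤ Fintype.card B) {s : Ty B} (hs : ¬ IsRes B s) : 2 ≤ Phi B s := by
  obtain ⟨b₁, b₂, hb, h₁, h₂⟩ := exists_two_off B h3 hs
  rw [← L_reg B s, L_eq_add_erase B (reg B s) s b₁]
  have h1 : 1 ≤ lee (s b₁ - reg B s) := by
    have := (lee_eq_zero_iff (s b₁ - reg B s)).not.mpr (sub_ne_zero.mpr h₁); omega
  have h2 : 1 ≤ lee (s b₂ - reg B s) := by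
    have := (lee_eq_zero_iff (s b₂ - reg B s)).not.mpr (sub_ne_zero.mpr h₂); omega
  have h3' : lee (s b₂ - reg B s) ≤ ∑ x ∈ univ.erase b₁, lee (s x - reg B s) :=
    Finset.single_le_sum (f := fun x => lee (s x - reg B s)) (fun _ _ => Nat.zero_le _) (Finset.mem_erase.mpr ⟨hb.symm, mem_univ _⟩)
  omega

omit [AddGroup B] in
/-- A constant type is residual and not a `2`-atom (`|B| ≥ 3`). [folklore] -/
theorem cst_isRes_not_two [Nonempty B] (h3 : 3 ≤ Fintype.card B) (u : ZMod 4) :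
    IsRes B (cst B u) ∧ ¬ ∃ (u' : ZMod 4) (b : B), cst B u = atom B u' b 2 :=
  ⟨⟨u, Classical.arbitrary B, 0, (atom_zero B u _).symm⟩, fun ⟨u', b, h⟩ => atom_ne_cst B h3 (by decide) u h.symm⟩

/-! ## §2 The face at a type, chosen by an explicit case distinction -/

omit [AddGroup B] in
/-- **The reducing face through a type of potential `≥ 2`, with its shape recorded** (`|B| ≥ 3`): (1) `T.1` non-residual → a coordinate-`0`
cross square with `Φ`-smaller corners; (2) `T.1 = u + 2δ_b` → the coordinate-`0` column face at `(cst u, T.2)`; (3) else, `T.2` non-residual → a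
coordinate-`1` cross square; (4) else, `T.2` a `2`-atom → the coordinate-`1` column face; (5) else the mixed square. [folklore] -/
theorem exists_rel' (h3 : 3 ≤ Fintype.card B) (T : Ty₂ B) (hT : 2 ≤ pot B T) :
    ∃ T₁ T₂ T₃ : Ty₂ B,
      IsFace₂ B (Pi.single T 1 - Pi.single T₁ 1 - Pi.single T₂ 1 + Pi.single T₃ 1 : Ty₂ B → ℤ) ∧
      (pot B T₁ < pot B T ∧ pot B T₂ < pot B T ∧ pot B T₃ < pot B T) ∧
      (¬ IsRes B T.1 → ∃ p q : ZMod 2 × B, p.2 ≠ q.2 ∧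
        (Pi.single T 1 - Pi.single T₁ 1 - Pi.single T₂ 1 + Pi.single T₃ 1 : Ty₂ B → ℤ) = tens B (faceVec B T.1 p q) (Pi.single T.2 1) ∧
        Phi B (QuarticTwist.flip B p T.1) < Phi B T.1 ∧ Phi B (QuarticTwist.flip B q T.1) < Phi B T.1 ∧
        Phi B (QuarticTwist.flip B q (QuarticTwist.flip B p T.1)) < Phi B T.1) ∧
      (∀ (u : ZMod 4) (b : B), T.1 = atom B u b 2 →
        (Pi.single T 1 - Pi.single T₁ 1 - Pi.single T₂ 1 + Pi.single T₃ 1 : Ty₂ B → ℤ) =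
          tens B (faceVec B (cst B u) ((0 : ZMod 2), b) ((1 : ZMod 2), b)) (Pi.single T.2 1)) ∧
      (IsRes B T.1 → (¬ ∃ (u : ZMod 4) (b : B), T.1 = atom B u b 2) → ¬ IsRes B T.2 → ∃ p q : ZMod 2 × B, p.2 ≠ q.2 ∧
        (Pi.single T 1 - Pi.single T₁ 1 - Pi.single T₂ 1 + Pi.single T₃ 1 : Ty₂ B → ℤ) = tens B (Pi.single T.1 1) (faceVec B T.2 p q) ∧
        Phi B (QuarticTwist.flip B p T.2) < Phi B T.2 ∧ Phi B (QuarticTwist.flip B q T.2) < Phi B T.2 ∧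
        Phi B (QuarticTwist.flip B q (QuarticTwist.flip B p T.2)) < Phi B T.2) ∧
      (IsRes B T.1 → (¬ ∃ (u : ZMod 4) (b : B), T.1 = atom B u b 2) → ∀ (u : ZMod 4) (b : B), T.2 = atom B u b 2 →
        (Pi.single T 1 - Pi.single T₁ 1 - Pi.single T₂ 1 + Pi.single T₃ 1 : Ty₂ B → ℤ) =
          tens B (Pi.single T.1 1) (faceVec B (cst B u) ((0 : ZMod 2), b) ((1 : ZMod 2), b))) ∧
      (∀ (u : ZMod 4) (b : B) (k : ZMod 4) (u' : ZMod 4) (b' : B) (k' : ZMod 4), T = (atom B u b k, atom B u' b' k') →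
        (k = 1 ∨ k = -1) → (k' = 1 ∨ k' = -1) →
        (Pi.single T 1 - Pi.single T₁ 1 - Pi.single T₂ 1 + Pi.single T₃ 1 : Ty₂ B → ℤ) =
          tens B (Pi.single (atom B u b k) 1 - Pi.single (cst B u) 1) (Pi.single (atom B u' b' k') 1 - Pi.single (cst B u') 1)) := by
  have pm1 : ∀ {k : ZMod 4}, (k = 1 ∨ k = -1) → k ≠ 0 ∧ k ≠ 2 := fun hk => by
    rcases hk with rfl | rfl <;> exact ⟨by decide, by decide⟩
  obtain ⟨s, t⟩ := T
  simp only [pot_mk] at hT ⊢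
  by_cases h1 : ¬ IsRes B s
  · -- (1) cross square in coordinate 0
    obtain ⟨p, q, hpq, hp, hq, hpq'⟩ := exists_goodSquare B h3 h1
    refine ⟨(QuarticTwist.flip B p s, t), (QuarticTwist.flip B q s, t), (QuarticTwist.flip B q (QuarticTwist.flip B p s), t),
      Or.inl ⟨s, t, p, q, fun h => hpq (by rw [h]), (cface₀_eq B s t p q).symm⟩,
      ⟨by rw [pot_mk]; omega, by rw [pot_mk]; omega, by rw [pot_mk]; omega⟩,
      fun _ => ⟨p, q, hpq, (cface₀_eq B s t p q).symm, hp, hq, hpq'⟩, ?_, fun h => absurd h h1, fun h => absurd h h1, ?_⟩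
    · rintro u b rfl
      exact absurd ⟨u, b, 2, rfl⟩ h1
    · intro u b k u' b' k' hT _ _
      exact absurd ⟨u, b, k, (Prod.ext_iff.mp hT).1⟩ h1
  rw [not_not] at h1
  by_cases h2 : ∃ (u : ZMod 4) (b : B), s = atom B u b 2
  · -- (2) column face in coordinate 0 at a 2-atom
    obtain ⟨u, b, rfl⟩ := h2
    refine ⟨(QuarticTwist.flip B (0, b) (atom B u b 2), t), (QuarticTwist.flip B (1, b) (atom B u b 2), t),
      (QuarticTwist.flip B (1, b) (QuarticTwist.flip B (0, b) (atom B u b 2)), t),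
      Or.inl ⟨atom B u b 2, t, (0, b), (1, b), fun h => zero_ne_one ((Prod.ext_iff.mp h).1 : (0 : ZMod 2) = 1),
        (cface₀_eq B _ t _ _).symm⟩, ⟨?_, ?_, ?_⟩, fun h => absurd ⟨u, b, 2, rfl⟩ h, ?_,
      fun _ h => absurd ⟨u, b, rfl⟩ h, fun _ h => absurd ⟨u, b, rfl⟩ h, ?_⟩
    · rw [pot_mk, Phi_atom B h3]; have := Phi_flip_two_atom_lt B h3 0 u b; show _ < lee 2 + _; rw [show lee 2 = 2 by rfl]; omega
    · rw [pot_mk, Phi_atom B h3]; have := Phi_flip_two_atom_lt B h3 1 u b; show _ < lee 2 + _; rw [show lee 2 = 2 by rfl]; omega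
    · rw [pot_mk, Phi_atom B h3, Phi_flip_flip_two_atom B h3]; show _ < lee 2 + _; rw [show lee 2 = 2 by rfl]; omega
    · intro u' b' h
      obtain ⟨hu, hb, -⟩ := (atom_eq_atom_iff B h3 (by decide : (2 : ZMod 4) ≠ 0)).mp h
      rw [← cface₀_eq, faceVec_two_atom, hu, hb]
    · intro u₁ b₁ k₁ u' b' k' hT hk _
      obtain ⟨-, -, h2k⟩ := (atom_eq_atom_iff B h3 (by decide : (2 : ZMod 4) ≠ 0)).mp (Prod.ext_iff.mp hT).1
      exact absurd h2k.symm (pm1 hk).2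
  have hs1 : Phi B s ≤ 1 := Phi_le_one_of_isRes B h3 h1 h2
  by_cases h3' : ¬ IsRes B t
  · -- (3) cross square in coordinate 1
    obtain ⟨p, q, hpq, hp, hq, hpq'⟩ := exists_goodSquare B h3 h3'
    refine ⟨(s, QuarticTwist.flip B p t), (s, QuarticTwist.flip B q t), (s, QuarticTwist.flip B q (QuarticTwist.flip B p t)),
      Or.inr (Or.inl ⟨s, t, p, q, fun h => hpq (by rw [h]), (cface₁_eq B s t p q).symm⟩),
      ⟨by rw [pot_mk]; omega, by rw [pot_mk]; omega, by rw [pot_mk]; omega⟩,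
      fun h => absurd h1 h, fun u b h => absurd ⟨u, b, h⟩ h2, fun _ _ _ => ⟨p, q, hpq, (cface₁_eq B s t p q).symm, hp, hq, hpq'⟩, ?_, ?_⟩
    · rintro _ _ u b rfl
      exact absurd ⟨u, b, 2, rfl⟩ h3'
    · intro u b k u' b' k' hT _ _
      exact absurd ⟨u', b', k', (Prod.ext_iff.mp hT).2⟩ h3'
  rw [not_not] at h3'
  by_cases h4 : ∃ (u : ZMod 4) (b : B), t = atom B u b 2
  · -- (4) column face in coordinate 1 at a 2-atom
    obtain ⟨u, b, rfl⟩ := h4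
    refine ⟨(s, QuarticTwist.flip B (0, b) (atom B u b 2)), (s, QuarticTwist.flip B (1, b) (atom B u b 2)),
      (s, QuarticTwist.flip B (1, b) (QuarticTwist.flip B (0, b) (atom B u b 2))),
      Or.inr (Or.inl ⟨s, atom B u b 2, (0, b), (1, b), fun h => zero_ne_one ((Prod.ext_iff.mp h).1 : (0 : ZMod 2) = 1),
        (cface₁_eq B s _ _ _).symm⟩), ⟨?_, ?_, ?_⟩, fun h => absurd h1 h, fun u' b' h => absurd ⟨u', b', h⟩ h2,
      fun _ _ h => absurd ⟨u, b, 2, rfl⟩ h, ?_, ?_⟩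
    · rw [pot_mk, Phi_atom B h3 u b 2]; have := Phi_flip_two_atom_lt B h3 0 u b; show _ < _ + lee 2; rw [show lee 2 = 2 by rfl]; omega
    · rw [pot_mk, Phi_atom B h3 u b 2]; have := Phi_flip_two_atom_lt B h3 1 u b; show _ < _ + lee 2; rw [show lee 2 = 2 by rfl]; omega
    · rw [pot_mk, Phi_atom B h3 u b 2, Phi_flip_flip_two_atom B h3]; show _ < _ + lee 2; rw [show lee 2 = 2 by rfl]; omega
    · intro _ _ u' b' h
      obtain ⟨hu, hb, -⟩ := (atom_eq_atom_iff B h3 (by decide : (2 : ZMod 4) ≠ 0)).mp h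
      rw [← cface₁_eq, faceVec_two_atom, hu, hb]
    · intro u₁ b₁ k₁ u' b' k' hT _ hk'
      obtain ⟨-, -, h2k⟩ := (atom_eq_atom_iff B h3 (by decide : (2 : ZMod 4) ≠ 0)).mp (Prod.ext_iff.mp hT).2
      exact absurd h2k.symm (pm1 hk').2
  have ht1 : Phi B t ≤ 1 := Phi_le_one_of_isRes B h3 h3' h4
  obtain ⟨u, b, k, hk, rfl⟩ := exists_atom_of_Phi_eq_one B h3 h1 (by omega)
  obtain ⟨u', b', k', hk', rfl⟩ := exists_atom_of_Phi_eq_one B h3 h3' (by omega)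
  refine ⟨(cst B u, atom B u' b' k'), (atom B u b k, cst B u'), (cst B u, cst B u'), ?_, ⟨?_, ?_, ?_⟩, fun h => absurd h1 h,
    fun u'' b'' h => absurd ⟨u'', b'', h⟩ h2, fun _ _ h => absurd h3' h, fun _ _ u'' b'' h => absurd ⟨u'', b'', h⟩ h4, ?_⟩
  · obtain ⟨j, hj⟩ := exists_flip_atom_eq_cst B u b hk
    obtain ⟨j', hj'⟩ := exists_flip_atom_eq_cst B u' b' hk'
    refine Or.inr (Or.inr ⟨atom B u b k, atom B u' b' k', (j, b), (j', b'), ?_⟩)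
    rw [hj, hj', tens_sub_sub, single_eq_tens, single_eq_tens, single_eq_tens, single_eq_tens]
  · rw [pot_mk, Phi_cst B h3 u b]; omega
  · rw [pot_mk, Phi_cst B h3 u' b']; omega
  · rw [pot_mk, Phi_cst B h3 u b, Phi_cst B h3 u' b']; omega
  · intro U V K U' V' K' hT _ _
    obtain ⟨hTs, hTt⟩ := Prod.ext_iff.mp hT
    obtain ⟨hu, hb, hkk⟩ := (atom_eq_atom_iff B h3 (pm1 hk).1).mp hTs
    obtain ⟨hu', hb', hkk'⟩ := (atom_eq_atom_iff B h3 (pm1 hk').1).mp hTt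
    subst hu hb hkk hu' hb' hkk'
    rw [tens_sub_sub, single_eq_tens, single_eq_tens, single_eq_tens, single_eq_tens]

end Summit.HodgeConjecture.CorCM.Census.OcticTwist
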